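import Literature.MathematicalPhysics.QuantumFieldTheory.Balaban1983to89.B9Eq342GreenPrimeSupBoundDecayCosh
import Literature.MathematicalPhysics.QuantumFieldTheory.Balaban1983to89.B9Eq349ConjugatedGreenBlockDecay
import Literature.MathematicalPhysics.QuantumFieldTheory.Balaban1983to89.B9Eq324PenaltyBlockLocal

/-!
# `Balaban1983to89.B9Eq342GreenPrimeSupBoundDecayClosed` — T. Bałaban, *Propagators for lattice gauge theories in a background field*, Commun. Math. Phys.
# **99** (1985) 389–434 [Balaban1985BackgroundPropagators] Thm 3.1 (3.42) p. 397 with Thm 3.11 p. 416, (3.24) p. 394 and (3.49) p. 399: **THE DECAY ROW OF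
# (3.42) AND ITS `L^∞ → L^∞` ROW SUM FOR PRINT's `G′(U)` ON THE DIAGONAL WINDOW — CLOSED: every displayed letter of the (D-A) assembly INHABITED BY NAME —
# (D-E) by ne9-leaf-01 g84's `exists_block_decay_Gp`, (D-P) by ne9-leaf-03 g69's `B9Eq324PenaltyBlockLocal.norm_laplacePrimeA_sub_covLaplace_apply_le_block_diagonal`
# (`p₂ = |a′|∕√c₁`), the one-block masses by its `norm_block_le_sqrt_mul` (`√μ = √(c₀L^d)`), (T) by `B9Eq342GreenPrimeSupBound` §0 (unitary `U`, `*`-trace,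
# compatible fibre norm), (W)+(D-FS) by `B9Eq342CoshWeightSite` ∕ `B5Eq129FreeResolventDecayedLetterSite`: `∃ C ≥ 0, ∀ U ∈ window, ∀ f, ∀ x₀,
# ‖(G′(U)f)(x₀)‖ ≤ B(C, a, κ′, k)·K_d(κ′∕2)·sup|f|`** — storey (D) of the NE9 owner's SUP-NORM PROGRAMME (plan v10 §5) COMPLETE for the chain's one-step
# site propagator; what remains displayed are print's standing hypotheses of the window (Thm 3.11 ∕ (3.35)-type letters of `exists_block_decay_Gp`), the
# tracial-norm letters, the rate `a` (`B9Eq342GreenPrimeSupBoundDecayCosh.rate_explicit`) and `κ′`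

statement-level skeleton of published theorems with citation tags; proofs where landed; nothing here is a claim about the Yang–Mills mass gap

CITATION HEADER (lean-in-tree rule).  Audit cell `pub-balaban`, sub-cell `t4`, BINDER row NE9; filed by the row OWNER lineage `b2b-balaban-t4-ne9-p1` (gen 90).
Sources as quoted verbatim in the imported files ([Balaban1985BackgroundPropagators] p. 397 Thm 3.1 (3.42) *«… |(G′(U)λ)(x)| … ≤ B₀e^{−δ₀d(y,y′)} for
x ∈ Δ(y), y ∈ Λ_j, supp λ ⊂ Δ(y′)»*, p. 416 Thm 3.11, (3.24) p. 394, (3.49) p. 399; print's random-walk proof pp. 415–426 NOT reproduced — the cell's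
route is Kato domination + Agmon weight + the chain's `L²` block decay).  NOTHING printed is used as a hypothesis; `[cite: …]` tags are TEXT LOCATIONS; the
statement is a `[folklore]` composition BY NAME (ABSOLUTE RULE).

WHAT IS PROVED (sorry-free; 0 `def`).  **`exists_rowSum_bound_closed`** — letters of `exists_block_decay_Gp` verbatim + `StarRing 𝔸` (the (T) files' class): `∃ C ≥ 0` such that for every background `U` of the window which is unitary for a `*`-trace `τ`
compatible with the fibre norm (`hU`, `hUε`, `hRS`, `hUstar`, `hτ₂`, `hφτ`), every (K1) block family, every rate `0 ≤ a` with `0 < λ`, every `0 < κ′ ≤ r`,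
`κ′ < aL`, every `k`, every `f` with `‖f(x)‖ ≤ F` and every site `x₀`:
`‖(G′(U)f)(x₀)‖ ≤ ((1 + (|a′|∕√c₁)(Ce^r)√(c₀L^d))·2e^{a(L−1)}·Σ_{l<k}λ^{−(l+1)} + √(λ^{−k}∕c₀)·√(2e^{a(L−1)}K_d(aL−κ′))·(Ce^r)·√(c₀L^d))·K_d(κ′∕2)·F`.
HONEST SCOPE.  Composition; constants crude; ONE STEP `fineP L m` at `ηL = 1` (the TOWER twin — the row the (N)-reading consumes — is open); VALUE row
(+ the trivial top-level ∇-row of `…DecayCosh` §3), no Hölder norms.  NOT summit progress (cell pub-balaban: NE9 NOT PRINTED ∕ NOT PROVED; «NE9 ⇐ the named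
binders»; row WALLED ON A MODEL (O-NE9-1; #5 UNRULED); spine PROVED 0∕9; rung (B)+1 finite T⁴ — NOT infinite volume, NOT mass gap, NOT BetaPertH, NOT Clay).
HONEST DEPENDENCY (cell line): continuum YM on T⁴ ⇐ BetaPertH ∧ nine spine estimates (0/9 proved); BetaPertH ⇐ (D1) ∧ (D4) ∧ CAP+tail; G-an2-4 gates asym, D1
and NE2/3/4.  NEW file importing `B9Eq342GreenPrimeSupBoundDecayCosh` + `B9Eq349ConjugatedGreenBlockDecay` + `B9Eq324PenaltyBlockLocal`; nothing modified.  Net new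
unproved facts: 0.
-/

noncomputable section

open scoped InnerProductSpace ComplexConjugate BigOperators

namespace Literature.MathematicalPhysics.QuantumFieldTheory.Balaban1983to89.B9Eq342GreenPrimeSupBoundDecayClosed

open B4Sect5Torus (TSite tdist)
open B4Sect5Proof (latticeConst)
open B9SectCLatticeCarrier (Bond shift unshift)
open B9Eq319QprimeTorus (fineP blockCoord)
open B9Eq311L2Pairing (WL2)
open B11Eq103H1Complex (SiteL2K covLaplaceSiteK)
open B7Prop1Explicit (U1)
open B9Eq310HessianOperator (adTransportW)
open B9Eq3119DeltaPiCarrier (laplacePrimeA GpOfU)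
open B9Thm311DeltaPrimeA (laplacePrimeA_pos_of_hRS)
open B9Eq349ConjugatedGreenBlockDecay (exists_block_decay_Gp)
open B9Eq342GreenPrimeSupBound (norm_adTransportW_eq norm_adTransportW_inv_eq)
open B9Eq324PenaltyBlockLocal (norm_laplacePrimeA_sub_covLaplace_apply_le_block_diagonal norm_block_le_sqrt_mul)
open B9Eq342GreenPrimeSupBoundDecayCosh (norm_GpOfU_apply_le_rowSum_cosh)

variable {d : ℕ} {L : ℕ} [NeZero L] {m : Fin d → ℕ} {𝔸 : Type*} [NormedRing 𝔸] [NormedAlgebra ℂ 𝔸] [NormOneClass 𝔸] [StarRing 𝔸]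
  {W : Type*} [NormedAddCommGroup W] [InnerProductSpace ℂ W] [FiniteDimensional ℂ W] {φ : W ≃ₗ[ℂ] 𝔸} {Mφ Mφ' : ℝ}
  (hφ : ∀ w, ‖φ w‖ ≤ Mφ * ‖w‖) (hφ' : ∀ X, ‖φ.symm X‖ ≤ Mφ' * ‖X‖) (hMφ : 0 ≤ Mφ) (hMφ' : 0 ≤ Mφ')
  {c₀ : ℝ} [Fact (0 < c₀)] {η : ℝ} (hη : 0 < η) {εU : ℝ} (hεU : 0 ≤ εU)
  {c₁ : ℝ} [Fact (0 < c₁)] (hc : c₁ = (L : ℝ) ^ d * c₀) {a' : ℝ} (ha' : 0 < a') (hηL : η * L = 1)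

include hφ hφ' hMφ hMφ' hη hεU hc ha' hηL in
/-- **STOREY (D) CLOSED FOR `G′(U)`: THE DECAY ROW OF (3.42) + ITS `L^∞ → L^∞` ROW SUM ON THE DIAGONAL WINDOW, EVERY ASSEMBLY LETTER INHABITED.**
Under the letters of `exists_block_decay_Gp` (the window), there is ONE `C ≥ 0` such that for every background `U` of the window, unitary for a `*`-trace
compatible with the fibre norm, every block family, every rate `a` (`0 < λ`), `0 < κ′ ≤ r`, `κ′ < aL`, every `k`, every bounded datum `‖f(x)‖ ≤ F` and every
site: `‖(G′(U)f)(x₀)‖ ≤ B·K_d(κ′∕2)·F` with `B` the displayed closed form in `(C e^r, |a′|∕√c₁, √(c₀L^d), a, λ, κ′, k, c₀, L, d)` — (D-E) := `exists_block_decay_Gp`,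
(D-P) := `norm_laplacePrimeA_sub_covLaplace_apply_le_block_diagonal`, masses := `norm_block_le_sqrt_mul`, (T) := `norm_adTransportW_eq ∕ _inv_eq`, (W)+(D-FS) :=
`…DecayCosh`. [cite: Balaban1985BackgroundPropagators, Thm 3.1 (3.42) p.397, Thm 3.11 p.416, (3.24) p.394, (3.49) p.399] -/
theorem exists_rowSum_bound_closed {γ β r : ℝ} (hγ : 0 < γ) (hβ : 0 ≤ β) (hr : 0 ≤ r)
    (hγc : γ ≤ 1 / (2 + 2 / a') -
        (Real.sqrt d * (‖((η : ℂ))⁻¹‖ * (2 * Mφ * Mφ' * εU)) + (Real.sqrt d * (‖((η : ℂ))⁻¹‖ * (2 * Mφ * Mφ' * εU))) ^ 2 +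
          a' * (((1 + 2 * Mφ * Mφ' * εU) ^ (d * (L - 1)) - 1)) * (2 + ((1 + 2 * Mφ * Mφ' * εU) ^ (d * (L - 1)) - 1))))
    {ℓ ℓ' : ℝ} (hℓ : 1 ≤ ℓ) (hℓ' : 1 ≤ ℓ') (hwin : r * ℓ * η ≤ 1) (hwin' : r * ℓ' ≤ 1)
    (hβD : 2 * r * ℓ * (Mφ * Mφ') * Real.sqrt d ≤ β) (hβQ : 2 * r * ℓ' * (1 + 2 * Mφ * Mφ' * εU) ^ (d * (L - 1)) ≤ β)
    (small : 3 * (1 + a') * β ^ 2 ≤ γ / 4) (hL : 1 ≤ L) (hm : ∀ i, 1 ≤ m i) :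
    ∃ C : ℝ, 0 ≤ C ∧ ∀ (U : Bond d (fineP L m) → 𝔸ˣ) (hU : ∀ b, U b ∈ U1 𝔸) (hUε : ∀ b, ‖(U b : 𝔸) - 1‖ ≤ εU)
      (hRS : ∀ (b : Bond d (fineP L m)) (v u : W), ⟪adTransportW φ U b v, u⟫_ℂ = ⟪v, adTransportW φ (fun b => (U b)⁻¹) b u⟫_ℂ)
      (τ : 𝔸 →ₗ[ℂ] ℂ) (_hτ₂ : ∀ X Y : 𝔸, τ (X * Y) = τ (Y * X)) (_hUstar : ∀ b, star (U b : 𝔸) = ((U b)⁻¹ : 𝔸ˣ))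
      (_hφτ : ∀ X Y : 𝔸, ⟪φ.symm X, φ.symm Y⟫_ℂ = τ (star X * Y))
      (PS : TSite d m → SiteL2K ℂ d (fineP L m) c₀ W →L[ℂ] SiteL2K ℂ d (fineP L m) c₀ W)
      (_hPS : ∀ (y : TSite d m) (g : SiteL2K ℂ d (fineP L m) c₀ W) (x : TSite d (fineP L m)),
        WL2.equiv ℂ (fun _ : TSite d (fineP L m) => c₀) W (PS y g) x =
          if blockCoord L m x = y then WL2.equiv ℂ (fun _ : TSite d (fineP L m) => c₀) W g x else 0)
      (κ' a : ℝ) (_ha : 0 ≤ a) (_hlam : 0 < 1 - 2 * d * (η⁻¹) ^ 2 * (Real.cosh a - 1))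
      (_hκ' : 0 < κ') (_hκ : κ' ≤ r) (_hκ₁ : κ' < a * L)
      (x₀ : TSite d (fineP L m)) (k : ℕ) (f : SiteL2K ℂ d (fineP L m) c₀ W) (F : ℝ) (_hF : ∀ y, ‖WL2.equiv ℂ _ W f y‖ ≤ F),
      ‖WL2.equiv ℂ _ W (GpOfU L m φ η U a' (c₁ := c₁)
          (fun x hx => laplacePrimeA_pos_of_hRS L m φ η U a' hη.ne' ha' hRS x hx) f) x₀‖ ≤
        ((1 + |a'| * (Real.sqrt c₁)⁻¹ * (C * Real.exp r) * Real.sqrt (c₀ * (L : ℝ) ^ d)) * (Real.exp (a * ((L : ℝ) - 1)) * 2) *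
              (∑ l ∈ Finset.range k, ((1 - 2 * d * (η⁻¹) ^ 2 * (Real.cosh a - 1)) ^ (l + 1))⁻¹) +
          Real.sqrt (((1 - 2 * d * (η⁻¹) ^ 2 * (Real.cosh a - 1)) ^ k)⁻¹ / c₀) *
            Real.sqrt ((Real.exp (a * ((L : ℝ) - 1)) * 2) * latticeConst d (a * L - κ')) * (C * Real.exp r) *
            Real.sqrt (c₀ * (L : ℝ) ^ d)) *
          latticeConst d (κ' / 2) * F := by
  obtain ⟨C, hC0, H⟩ := exists_block_decay_Gp hφ hφ' hMφ hMφ' hη hεU hc ha' hηL hγ hβ hr hγc hℓ hℓ' hwin hwin' hβD hβQ small hL hm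
  refine ⟨C, hC0, fun U hU hUε hRS τ hτ₂ hUstar hφτ PS hPS κ' a ha hlam hκ' hκ hκ₁ x₀ k f F hF => ?_⟩
  -- (T): the transporters are isometries of the fibre (unitary `U`, `*`-trace, compatible fibre norm)
  have hR : ∀ b w, ‖adTransportW φ U b w‖ ≤ ‖w‖ := fun b w => (norm_adTransportW_eq φ U τ hτ₂ hUstar hφτ b w).le
  have hS : ∀ b w, ‖adTransportW φ (fun b => (U b)⁻¹) b w‖ ≤ ‖w‖ := fun b w => (norm_adTransportW_inv_eq φ U τ hτ₂ hUstar hφτ b w).le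
  -- (D-E): the chain's `L²` block decay, uniform in the window
  have hdec : ∀ v y : TSite d m, ‖PS y ∘L LinearMap.toContinuousLinearMap (GpOfU L m φ η U a' (c₁ := c₁)
      (fun x hx => laplacePrimeA_pos_of_hRS L m φ η U a' hη.ne' ha' hRS x hx)) ∘L PS v‖ ≤
        C * Real.exp r * Real.exp (-(r * tdist m v y)) := fun v y => H U hU hUε hRS PS hPS v y
  -- (D-P): the block-local penalty on the diagonal
  have hP : ∀ (v : SiteL2K ℂ d (fineP L m) c₀ W) (x : TSite d (fineP L m)),
      ‖WL2.equiv ℂ _ W (laplacePrimeA L m φ η U a' (c₁ := c₁) v -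
        covLaplaceSiteK ((η : ℂ))⁻¹ (adTransportW φ U) (adTransportW φ fun b => (U b)⁻¹) v) x‖ ≤
        |a'| * (Real.sqrt c₁)⁻¹ * ‖PS (blockCoord L m x) v‖ := fun v x =>
    norm_laplacePrimeA_sub_covLaplace_apply_le_block_diagonal L m φ U hPS hR (c₁ := c₁) hc η a' v x
  -- the one-block masses
  have hF0 : 0 ≤ F := (norm_nonneg _).trans (hF x₀)
  have hμ : ∀ v, ‖PS v f‖ ≤ Real.sqrt (c₀ * (L : ℝ) ^ d) * F := fun v =>
    norm_block_le_sqrt_mul L m hPS v f hF0 (fun x _ => hF x)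
  exact norm_GpOfU_apply_le_rowSum_cosh L m φ η U a' _ (c₁ := c₁) hm hR hS hPS (by positivity) (mul_nonneg hC0 (Real.exp_pos _).le) ha hlam
    hκ' hκ hκ₁ hP hdec x₀ k f hF hμ

end Literature.MathematicalPhysics.QuantumFieldTheory.Balaban1983to89.B9Eq342GreenPrimeSupBoundDecayClosed

end
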